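import Summits.Ventures.WeilGRH.TwistedParityBonus
import HarnessLib

/-!
# GRH arm (rh-explicit, venture WeilGRH): parity-free certificate interfaces — one Gram matrix per character

Cell `rh-explicit`, WEIL TRACK — GRH ARM (typing seat weil-grh-1).  By `TwistedParityBonus.lean` the parity bonus
is non-negative, so the EVEN-parity Gram objects certify characters of EITHER parity.  This file packages the
parity-free entry points for the χ-certificate producers (EXTREMALS/GRH, format C/E and Kt-closure lineages):

* `weilPositivityOnChar_of_twistedGramCoeff_sector_psd_real` — for a REAL character χ (`conj χ = χ`, any parity),
  per-sector PSD of `twistedGramCoeff χ a` (Yoshida's `gramCoeff − polarCoeff` + `(log q)δ` + the prime corrections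
  `(χ(k) − 1)Λ(k)k^{-1/2}(incrCoeff_{log k} − 2δ)`) for every `N` ⟹ `WeilPositivityOnChar χ a`;
* `weilPositivityOnChar_of_formatC_certificates_real` — format C (block certificate + far diagonal bound + coupling
  majorant per sector, weil-10's `sum_range_mul_mul_nonneg_of_certificate_sum`) for `G = twistedGramCoeff χ a`,
  any parity ⟹ the rung;
* `weilPositivityOnChar_of_twistedGramCoeffC_psd_any` — for ANY character, hermitian PSD of `twistedGramCoeffC χ a`
  on every `modes N` ⟹ the rung; `weilPositivityOnChar_of_twistedGramCoeffC_realify_any` — its J-real form.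

(For odd χ the sharper objects `twistedGramCoeffOdd` / `twistedGramCoeffOddC`, which keep the bonus, remain available.)
No definitions; no named facts; RH/GRH-free.
-/

set_option autoImplicit false

noncomputable section

open Complex Finset Matrix
open scoped Real ComplexConjugate

namespace Summit.Ventures.WeilGRH

open Literature.NumberTheory.LFunctions
open Literature.NumberTheory.LFunctions.Yoshida1992 (modes chi)
open Summit.RiemannHypothesis.RiemannHypothesis.Theorems.WeilFormatC

variable {q : ℕ} {a : ℝ}

/-- The parity exponent is `0` or `1`. -/
theorem charParity_eq_zero_or_one (χ : DirichletCharacter ℂ q) : charParity χ = 0 ∨ charParity χ = 1 := by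
  unfold charParity; split_ifs <;> simp

/-- **REAL character, ANY parity: per-sector PSD of the even-parity matrix `twistedGramCoeff χ a` gives the rung**
(`q ≠ 1`, `a > 0`, `conj χ = χ`). -/
theorem weilPositivityOnChar_of_twistedGramCoeff_sector_psd_real (hq : q ≠ 1) (χ : DirichletCharacter ℂ q)
    (hχ : ∀ n : ℕ, conj (χ (n : ZMod q)) = χ (n : ZMod q)) (ha : 0 < a)
    (hev : ∀ (N : ℕ) (y : ℕ → ℝ), 0 ≤ ∑ n ∈ Finset.range (N + 1), ∑ m ∈ Finset.range (N + 1),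
      y n * y m * (if n = 0 then twistedGramCoeff χ a 0 m else if m = 0 then twistedGramCoeff χ a n 0
        else (twistedGramCoeff χ a n m + twistedGramCoeff χ a n (-(m : ℤ))) / 2))
    (hod : ∀ (N : ℕ) (z : ℕ → ℝ), 0 ≤ ∑ k ∈ Finset.range N, ∑ l ∈ Finset.range N,
      z k * z l * ((twistedGramCoeff χ a ((k : ℤ) + 1) ((l : ℤ) + 1) -
        twistedGramCoeff χ a ((k : ℤ) + 1) (-((l : ℤ) + 1))) / 2)) :
    WeilPositivityOnChar χ a := by
  rcases charParity_eq_zero_or_one χ with h | h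
  · exact weilPositivityOnChar_of_twistedGramCoeff_sector_psd hq χ hχ h ha hev hod
  · exact weilPositivityOnChar_of_twistedGramCoeff_sector_psd_odd hq χ hχ h ha hev hod

/-- **FORMAT C for a REAL character of ANY parity ⟹ `WeilPositivityOnChar χ a`** (`G = twistedGramCoeff χ a`;
the parity bonus is dropped for odd χ). -/
theorem weilPositivityOnChar_of_formatC_certificates_real (hq : q ≠ 1) (χ : DirichletCharacter ℂ q)
    (hχ : ∀ n : ℕ, conj (χ (n : ZMod q)) = χ (n : ZMod q)) (ha : 0 < a)
    (Be : ℕ) (de : ℕ → ℝ) (Ue : Matrix (Fin Be) (Fin Be) ℝ) (hde : ∀ m, Be ≤ m → 0 < de m)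
    (hfar_e : ∀ (N : ℕ) (y : ℕ → ℝ),
      ∑ n ∈ Ico Be N, de n * y n ^ 2 ≤ ∑ n ∈ Ico Be N, ∑ m ∈ Ico Be N,
        y n * (if n = 0 then twistedGramCoeff χ a 0 m else if m = 0 then twistedGramCoeff χ a n 0
          else (twistedGramCoeff χ a n m + twistedGramCoeff χ a n (-(m : ℤ))) / 2) * y m)
    (hU_e : ∀ (N : ℕ) (x : Fin Be → ℝ),
      ∑ m ∈ Ico Be N, (∑ i : Fin Be,
        (if (i : ℕ) = 0 then twistedGramCoeff χ a 0 m else if m = 0 then twistedGramCoeff χ a i 0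
          else (twistedGramCoeff χ a i m + twistedGramCoeff χ a i (-(m : ℤ))) / 2) * x i) ^ 2 / de m ≤
        x ⬝ᵥ Ue *ᵥ x)
    (hS_e : ∀ x : Fin Be → ℝ, 0 ≤ ∑ i, ∑ j, x i * x j *
      ((if (i : ℕ) = 0 then twistedGramCoeff χ a 0 j else if (j : ℕ) = 0 then twistedGramCoeff χ a i 0
        else (twistedGramCoeff χ a i j + twistedGramCoeff χ a i (-(j : ℤ))) / 2) - Ue i j))
    (Bo : ℕ) (dod : ℕ → ℝ) (Uo : Matrix (Fin Bo) (Fin Bo) ℝ) (hdo : ∀ m, Bo ≤ m → 0 < dod m)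
    (hfar_o : ∀ (N : ℕ) (z : ℕ → ℝ),
      ∑ k ∈ Ico Bo N, dod k * z k ^ 2 ≤ ∑ k ∈ Ico Bo N, ∑ l ∈ Ico Bo N,
        z k * ((twistedGramCoeff χ a ((k : ℤ) + 1) ((l : ℤ) + 1) -
          twistedGramCoeff χ a ((k : ℤ) + 1) (-((l : ℤ) + 1))) / 2) * z l)
    (hU_o : ∀ (N : ℕ) (x : Fin Bo → ℝ),
      ∑ l ∈ Ico Bo N, (∑ i : Fin Bo,
        ((twistedGramCoeff χ a ((i : ℤ) + 1) ((l : ℤ) + 1) -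
          twistedGramCoeff χ a ((i : ℤ) + 1) (-((l : ℤ) + 1))) / 2) * x i) ^ 2 / dod l ≤ x ⬝ᵥ Uo *ᵥ x)
    (hS_o : ∀ x : Fin Bo → ℝ, 0 ≤ ∑ i, ∑ j, x i * x j *
      ((twistedGramCoeff χ a ((i : ℤ) + 1) ((j : ℤ) + 1) -
        twistedGramCoeff χ a ((i : ℤ) + 1) (-((j : ℤ) + 1))) / 2 - Uo i j)) :
    WeilPositivityOnChar χ a := by
  have hsymm := twistedGramCoeff_comm χ a
  have hrefl := twistedGramCoeff_neg_neg χ a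
  refine weilPositivityOnChar_of_twistedGramCoeff_sector_psd_real hq χ hχ ha (fun N y ↦ ?_) (fun N z ↦ ?_)
  · exact sum_range_mul_mul_nonneg_of_certificate_sum
      (fun n m : ℕ ↦ if n = 0 then twistedGramCoeff χ a 0 m else if m = 0 then twistedGramCoeff χ a n 0
        else (twistedGramCoeff χ a n m + twistedGramCoeff χ a n (-(m : ℤ))) / 2)
      (fun n m ↦ evenKernel_symm _ hsymm hrefl n m) Be de Ue hde hfar_e hU_e hS_e (N + 1) y
  · exact sum_range_mul_mul_nonneg_of_certificate_sum
      (fun k l : ℕ ↦ (twistedGramCoeff χ a ((k : ℤ) + 1) ((l : ℤ) + 1) -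
        twistedGramCoeff χ a ((k : ℤ) + 1) (-((l : ℤ) + 1))) / 2)
      (fun k l ↦ oddKernel_symm _ hsymm hrefl k l) Bo dod Uo hdo hfar_o hU_o hS_o N z

/-- **ANY character: hermitian PSD of the even-parity kernel `twistedGramCoeffC χ a` on every `modes N` gives
the rung** (`q ≠ 1`, `a > 0`). -/
theorem weilPositivityOnChar_of_twistedGramCoeffC_psd_any (hq : q ≠ 1) (χ : DirichletCharacter ℂ q)
    (ha : 0 < a)
    (hpsd : ∀ (N : ℕ) (c : ℤ → ℂ),
      0 ≤ ∑ n ∈ modes N, ∑ m ∈ modes N, (conj (c n) * c m * twistedGramCoeffC χ a n m).re) :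
    WeilPositivityOnChar χ a := by
  rcases charParity_eq_zero_or_one χ with h | h
  · exact weilPositivityOnChar_of_twistedGramCoeffC_psd hq χ h ha hpsd
  · exact weilPositivityOnChar_of_twistedGramCoeffC_psd_odd hq χ h ha hpsd

/-- **ANY character, J-real form**: non-negativity of the real quadratic form of
`[[Re G, −Im G],[Im G, Re G]]`, `G = twistedGramCoeffC χ a` on `modes N`, for every `N` and all real `(x, y)`
⟹ `WeilPositivityOnChar χ a`. -/
theorem weilPositivityOnChar_of_twistedGramCoeffC_realify_any (hq : q ≠ 1) (χ : DirichletCharacter ℂ q)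
    (ha : 0 < a)
    (h : ∀ (N : ℕ) (x y : ℤ → ℝ), 0 ≤ ∑ n ∈ modes N, ∑ m ∈ modes N,
      (x n * x m * (twistedGramCoeffC χ a n m).re + y n * y m * (twistedGramCoeffC χ a n m).re -
        x n * y m * (twistedGramCoeffC χ a n m).im + y n * x m * (twistedGramCoeffC χ a n m).im)) :
    WeilPositivityOnChar χ a :=
  weilPositivityOnChar_of_twistedGramCoeffC_psd_any hq χ ha fun N c ↦ by
    rw [show (∑ n ∈ modes N, ∑ m ∈ modes N, (conj (c n) * c m * twistedGramCoeffC χ a n m).re) =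
        ∑ n ∈ modes N, ∑ m ∈ modes N, ((c n).re * (c m).re * (twistedGramCoeffC χ a n m).re +
          (c n).im * (c m).im * (twistedGramCoeffC χ a n m).re -
          (c n).re * (c m).im * (twistedGramCoeffC χ a n m).im +
          (c n).im * (c m).re * (twistedGramCoeffC χ a n m).im) from by
      refine Finset.sum_congr rfl fun n _ ↦ Finset.sum_congr rfl fun m _ ↦ ?_
      simp only [Complex.mul_re, Complex.mul_im, Complex.conj_re, Complex.conj_im]
      ring]
    exact h N (fun n ↦ (c n).re) (fun n ↦ (c n).im)

end Summit.Ventures.WeilGRH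

end
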